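import Mathlib

/-!
# No-small-body equations for `Δ(det_m)` — combinatorial and algebraic tools

Crux `ValuativeGCT.ValuativeFlip` (stmt-ValiantsHypothesis-12624), wall-breaker axis D
("det-orbit-closure multiplicity bounds for `detCensus`", seat k3 gen 1/2).  Second file of the
chain proving `K_m(λ*) = a_λ(δ[m])` for every shape of body `|λ̄| ≤ m`
(`ValuativeGCTValuativeFlipNoSmallBodyEquations`).  The proof evaluates a weight vector `F` of
`ℂ[Sym^m ℂ^{m²}]` on the generic small-body test form
`G = X_u^{m-b} ∏_{k ∈ J} (X_u^{a_k} + T_k x^{γ_k})` (a point of `Δ(det_m)` for every value of the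
parameters, file `…LinearEntryDeterminants`) and extracts the coefficient of the square-free
parameter monomial `T^J`.  This file contains the generic, crux-free parts of that computation:

* `nsb_testForm_expand`: `G = Σ_{A ⊆ J} T^A · x^{e(A)}`, `e(A) = (m - Σ_A a) ε_u + Σ_A γ_k`,
  and its specialisations `nsb_map_testForm`;
* `nsb_coeff_prod_sum_indicator`: the coefficient of `T^J` in a product of sums of square-free
  monomials `T^A` COUNTS the families of blocks whose indicator functions add up to `𝟙_J`
  (i.e. the partitions of `J` into admissible blocks);
* `nsb_core_count`: the minimal-coarsening lemma — if the blocks of such a family are empty exactly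
  at the "top" slots, singletons read back their slot label, and there are at least as many non-top
  slots as elements of `J`, then the multiset of non-top slot labels equals the multiset of labels
  of `J`;
* bookkeeping: degrees of indicator sums, the label multiset of the slot set of a monomial
  (`nsb_sum_single_fst_slots`), recovery of a monomial from its body and its degree.

Everything is elementary [folklore].
-/

-- `Summit.ValiantsHypothesis.ValiantsHypothesis.…` is the tree's mandated single-conjunct layout (Sub = Summit).
set_option linter.dupNamespace false

namespace Summit.ValiantsHypothesis.ValiantsHypothesis.Theorems.ValuativeFlip

open scoped BigOperators

/-! ## Degrees of indicator sums -/

section Degree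

variable {α : Type*}

/-- The degree of a finite sum of exponent vectors is the sum of the degrees. [folklore] -/
theorem nsb_degree_sum {ι : Type*} (s : Finset ι) (f : ι → α →₀ ℕ) :
    (∑ i ∈ s, f i).degree = ∑ i ∈ s, (f i).degree :=
  map_sum Finsupp.degree f s

/-- The indicator `𝟙_A = Σ_{j ∈ A} ε_j` has degree `#A`. [folklore] -/
theorem nsb_degree_sum_single_one (A : Finset α) :
    (∑ j ∈ A, Finsupp.single j 1 : α →₀ ℕ).degree = A.card := by
  rw [nsb_degree_sum, Finset.card_eq_sum_ones]
  exact Finset.sum_congr rfl fun j _ => Finsupp.degree_single j 1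

/-- A monomial is recovered from its body (all exponents but one) and its degree. [folklore] -/
theorem nsb_eq_of_erase_eq_of_degree_eq [DecidableEq α] {s s' : α →₀ ℕ} (a : α)
    (h : s'.erase a = s.erase a) (hd : s'.degree = s.degree) : s' = s := by
  have h1 := Finsupp.erase_add_single a s
  have h2 := Finsupp.erase_add_single a s'
  have hd1 := congrArg Finsupp.degree h1
  have hd2 := congrArg Finsupp.degree h2
  rw [map_add, Finsupp.degree_single] at hd1 hd2
  rw [h, hd] at hd2
  have ha : s' a = s a := by omega
  rw [← h2, ← h1, h, ha]

end Degree

/-! ## Slot sets of a monomial: labels and indicators -/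

section Slots

variable {ι : Type*}

/-- The label multiset of the non-top slots of a monomial `s` (slots = pairs `⟨d, i⟩`, `i < s d`;
"non-top" = `d ≠ dτ`), written as a sum of unit exponent vectors, is `s` with the top coordinate
erased. [folklore] -/
theorem nsb_sum_single_fst_slots [DecidableEq ι] (s : ι →₀ ℕ) (dτ : ι) :
    ∑ k ∈ (s.support.sigma fun d => Finset.range (s d)).filter (fun k => k.1 ≠ dτ),
        (Finsupp.single k.1 1 : ι →₀ ℕ) = s.erase dτ := by
  classical
  rw [Finset.sum_filter, Finset.sum_sigma]
  have hinner : ∀ d ∈ s.support, (∑ i ∈ Finset.range (s d),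
      (if (⟨d, i⟩ : Σ _ : ι, ℕ).1 ≠ dτ then (Finsupp.single (⟨d, i⟩ : Σ _ : ι, ℕ).1 1 : ι →₀ ℕ) else 0))
        = if d ≠ dτ then Finsupp.single d (s d) else 0 := by
    intro d _
    have hc : ∀ i ∈ Finset.range (s d),
        (if (⟨d, i⟩ : Σ _ : ι, ℕ).1 ≠ dτ then (Finsupp.single (⟨d, i⟩ : Σ _ : ι, ℕ).1 1 : ι →₀ ℕ) else 0)
          = if d ≠ dτ then Finsupp.single d 1 else 0 := fun i _ => rfl
    rw [Finset.sum_congr rfl hc, Finset.sum_const, Finset.card_range]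
    split_ifs
    · rw [Finsupp.smul_single, smul_eq_mul, mul_one]
    · rw [smul_zero]
  rw [Finset.sum_congr rfl hinner, ← Finset.sum_filter, Finset.filter_ne', ← Finsupp.support_erase]
  conv_rhs => rw [← Finsupp.sum_single (s.erase dτ)]
  rw [Finsupp.sum]
  refine Finset.sum_congr rfl fun d hd => ?_
  rw [Finsupp.support_erase, Finset.mem_erase] at hd
  rw [Finsupp.erase_ne hd.1]

/-- The diagonal block family (`{k}` at non-top slots, `∅` at top slots) has indicator sum the
indicator of the non-top slots. [folklore] -/
theorem nsb_sum_indicator_diag {κ : Type*} [DecidableEq κ] (K : Finset κ) (P : κ → Prop) [DecidablePred P] :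
    ∑ k ∈ K, ∑ j ∈ (if P k then ({k} : Finset κ) else ∅), (Finsupp.single j 1 : κ →₀ ℕ) =
      ∑ j ∈ K.filter P, Finsupp.single j 1 := by
  rw [Finset.sum_filter]
  refine Finset.sum_congr rfl fun k _ => ?_
  split_ifs
  · rw [Finset.sum_singleton]
  · rw [Finset.sum_empty]

end Slots

/-! ## The minimal-coarsening count -/

section Count

/-- **Minimal coarsening.**  Let `J` be a finite set with labels `π₀ : κ → ι`, `K'` a finite set
of slots with labels `π : κ' → ι` and a distinguished "top" label `dτ`, and `p` a family of blocks
`p k ⊆ κ` whose indicators add up to the indicator of `J` (so the blocks partition `J`).  Suppose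
the block of a slot is empty exactly when the slot is a top slot, a singleton block `{j}` reads
back the label of its slot (`π₀ j = π k`), and `J` has at most as many elements as there are
non-top slots.  Then every non-top block is a singleton, and the label multiset of the non-top
slots equals the label multiset of `J`. [folklore] -/
theorem nsb_core_count {ι κ κ' : Type*} [DecidableEq ι] [DecidableEq κ] [DecidableEq κ']
    (π₀ : κ → ι) (π : κ' → ι) (dτ : ι) (J : Finset κ) (K' : Finset κ') (p : κ' → Finset κ)
    (hempty : ∀ k ∈ K', p k = ∅ → π k = dτ)
    (htop : ∀ k ∈ K', π k = dτ → p k = ∅)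
    (hsingle : ∀ k ∈ K', ∀ j, p k = {j} → π₀ j = π k)
    (hsum : ∑ k ∈ K', ∑ j ∈ p k, (Finsupp.single j 1 : κ →₀ ℕ) = ∑ j ∈ J, Finsupp.single j 1)
    (hcard : J.card ≤ (K'.filter fun k => π k ≠ dτ).card) :
    ∑ k ∈ K'.filter (fun k => π k ≠ dτ), (Finsupp.single (π k) 1 : ι →₀ ℕ) =
      ∑ j ∈ J, Finsupp.single (π₀ j) 1 := by
  classical
  -- (A) total size of the blocks
  have hdeg := congrArg Finsupp.degree hsum
  rw [nsb_degree_sum, nsb_degree_sum_single_one] at hdeg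
  simp only [nsb_degree_sum_single_one] at hdeg
  -- (B) the top slots contribute nothing, the non-top slots at least one each
  set K₁ := K'.filter fun k => π k ≠ dτ with hK₁
  have hsplit : ∑ k ∈ K₁, (p k).card = J.card := by
    rw [← hdeg, hK₁]
    refine Finset.sum_filter_of_ne fun k hk hne => ?_
    intro heq
    rw [htop k hk heq, Finset.card_empty] at hne
    exact hne rfl
  have hge : ∀ k ∈ K₁, 1 ≤ (p k).card := by
    intro k hk
    rw [hK₁, Finset.mem_filter] at hk
    rw [Nat.one_le_iff_ne_zero, Ne, Finset.card_eq_zero]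
    exact fun h => hk.2 (hempty k hk.1 h)
  have hle : ∑ k ∈ K₁, (p k).card ≤ ∑ k ∈ K₁, 1 := by
    rw [hsplit, ← Finset.card_eq_sum_ones]; exact hcard
  have hone : ∀ k ∈ K₁, (p k).card = 1 := by
    have heq : ∑ k ∈ K₁, (1 : ℕ) = ∑ k ∈ K₁, (p k).card :=
      le_antisymm (Finset.sum_le_sum hge) hle
    intro k hk
    exact ((Finset.sum_eq_sum_iff_of_le hge).mp heq k hk).symm
  -- (C) non-top blocks are singletons reading back their labels
  have hC : ∑ k ∈ K₁, (Finsupp.single (π k) 1 : ι →₀ ℕ) =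
      ∑ k ∈ K', ∑ j ∈ p k, Finsupp.single (π₀ j) 1 := by
    rw [hK₁]
    symm
    rw [← Finset.sum_filter_of_ne (p := fun k => π k ≠ dτ)]
    · refine Finset.sum_congr rfl fun k hk => ?_
      have hk1 : k ∈ K₁ := by rw [hK₁]; exact hk
      obtain ⟨j, hj⟩ := Finset.card_eq_one.mp (hone k hk1)
      rw [Finset.mem_filter] at hk
      rw [hj, Finset.sum_singleton, hsingle k hk.1 j hj]
    · intro k hk hne heq
      rw [htop k hk heq, Finset.sum_empty] at hne
      exact hne rfl
  -- (D) push the partition identity forward along the labels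
  have hD := congrArg (Finsupp.mapDomain π₀) hsum
  simp only [Finsupp.mapDomain_finsetSum, Finsupp.mapDomain_single] at hD
  rw [hC, hD]

end Count

/-! ## The generic small-body test form: expansion and specialisation -/

section Expansion

open MvPolynomial

variable {σ κ R : Type*} [CommSemiring R]

/-- A product of monomials is the monomial of the summed exponents with the product coefficient. [folklore] -/
theorem nsb_prod_monomial (A : Finset κ) (γ : κ → σ →₀ ℕ) (c : κ → R) :
    ∏ k ∈ A, (monomial (γ k) (c k) : MvPolynomial σ R) = monomial (∑ k ∈ A, γ k) (∏ k ∈ A, c k) := by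
  classical
  induction A using Finset.induction_on with
  | empty => simp
  | @insert k A hk ih =>
    rw [Finset.prod_insert hk, Finset.sum_insert hk, Finset.prod_insert hk, ih, monomial_mul]

/-- **Expansion of the test form.**  With `b = Σ_{k ∈ J} a_k ≤ m`:
`X_u^{m-b} · ∏_{k ∈ J} (X_u^{a_k} + c_k · x^{γ_k}) = Σ_{A ⊆ J} (∏_{k ∈ A} c_k) · x^{e(A)}`,
`e(A) = (m - Σ_{k ∈ A} a_k) ε_u + Σ_{k ∈ A} γ_k`. [folklore] -/
theorem nsb_testForm_expand [DecidableEq σ] [DecidableEq κ] (J : Finset κ) (u : σ) (a : κ → ℕ)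
    (γ : κ → σ →₀ ℕ) (c : κ → R) {m : ℕ} (hm : ∑ k ∈ J, a k ≤ m) :
    (X u ^ (m - ∑ k ∈ J, a k) * ∏ k ∈ J, (X u ^ (a k) + c k • monomial (γ k) 1) : MvPolynomial σ R) =
      ∑ A ∈ J.powerset, monomial (Finsupp.single u (m - ∑ k ∈ A, a k) + ∑ k ∈ A, γ k) (∏ k ∈ A, c k) := by
  have hprod : ∏ k ∈ J, (X u ^ (a k) + c k • monomial (γ k) 1 : MvPolynomial σ R) =
      ∏ k ∈ J, (monomial (γ k) (c k) + X u ^ (a k)) := by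
    refine Finset.prod_congr rfl fun k _ => ?_
    rw [add_comm, smul_monomial, smul_eq_mul, mul_one]
  rw [hprod, Finset.prod_add, Finset.mul_sum]
  refine Finset.sum_congr rfl fun A hA => ?_
  rw [Finset.mem_powerset] at hA
  rw [nsb_prod_monomial, Finset.prod_pow_eq_pow_sum, X_pow_eq_monomial, X_pow_eq_monomial,
    monomial_mul, monomial_mul, one_mul, mul_one]
  congr 1
  have hsum := Finset.sum_sdiff hA (f := a)
  have harith : m - ∑ k ∈ J, a k + ∑ k ∈ J \ A, a k = m - ∑ k ∈ A, a k := by omega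
  rw [add_comm (∑ k ∈ A, γ k), ← add_assoc, ← Finsupp.single_add, harith]

/-- Coefficients of the expanded test form: the coefficient of `x^{e₀}` collects the blocks `A`
with `e(A) = e₀`. [folklore] -/
theorem nsb_coeff_sum_monomial [DecidableEq σ] (P : Finset (Finset κ)) (e : Finset κ → σ →₀ ℕ)
    (c : Finset κ → R) (e₀ : σ →₀ ℕ) :
    coeff e₀ (∑ A ∈ P, (monomial (e A) (c A) : MvPolynomial σ R)) = ∑ A ∈ P.filter (fun A => e A = e₀), c A := by
  classical
  rw [coeff_sum, Finset.sum_filter]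
  refine Finset.sum_congr rfl fun A _ => ?_
  rw [coeff_monomial]

/-- **Specialisation of the generic test form.**  Over the parameter ring `ℂ[T_k]`, evaluating the
parameters at `t` turns `X_u^n · ∏ (X_u^{a_k} + T_k · x^{γ_k})` into `X_u^n · ∏ (X_u^{a_k} + t_k · x^{γ_k})`.
[folklore] -/
theorem nsb_map_eval_testForm (J : Finset κ) (u : σ) (a : κ → ℕ) (γ : κ → σ →₀ ℕ) (n : ℕ) (t : κ → ℂ) :
    MvPolynomial.map (MvPolynomial.eval t)
        (X u ^ n * ∏ k ∈ J, (X u ^ (a k) + (X k : MvPolynomial κ ℂ) • monomial (γ k) 1) :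
          MvPolynomial σ (MvPolynomial κ ℂ)) =
      X u ^ n * ∏ k ∈ J, (X u ^ (a k) + t k • monomial (γ k) 1) := by
  rw [map_mul, map_pow, map_X, map_prod]
  refine congrArg _ (Finset.prod_congr rfl fun k _ => ?_)
  rw [map_add, map_pow, map_X, smul_monomial, smul_monomial, smul_eq_mul, mul_one, smul_eq_mul,
    mul_one, map_monomial, eval_X]

end Expansion

/-! ## The coefficient of the square-free parameter monomial counts block partitions -/

section Coefficient

open MvPolynomial

/-- **Partition count.**  For a finite family of slots `K'` and admissible block sets `𝒜 k`, the
coefficient of the square-free monomial `T^J = ∏_{j ∈ J} T_j` in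
`∏_{k ∈ K'} Σ_{A ∈ 𝒜 k} T^A` is the NUMBER of choices of admissible blocks, one per slot, whose
indicators add up to `𝟙_J` (equivalently: which partition `J`). [folklore] -/
theorem nsb_coeff_prod_sum_indicator {κ κ' R : Type*} [DecidableEq κ] [DecidableEq κ'] [CommSemiring R]
    (K' : Finset κ') (𝒜 : κ' → Finset (Finset κ)) (J : Finset κ) :
    coeff (∑ j ∈ J, Finsupp.single j 1)
        (∏ k ∈ K', ∑ A ∈ 𝒜 k, ∏ j ∈ A, (X j : MvPolynomial κ R)) =
      (((K'.pi 𝒜).filter fun p => ∑ k ∈ K'.attach, ∑ j ∈ p k.1 k.2, (Finsupp.single j 1 : κ →₀ ℕ) =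
          ∑ j ∈ J, Finsupp.single j 1).card : R) := by
  classical
  have hmono : ∀ A : Finset κ, ∏ j ∈ A, (X j : MvPolynomial κ R) = monomial (∑ j ∈ A, Finsupp.single j 1) 1 := by
    intro A
    rw [monomial_sum_one]
    rfl
  simp only [hmono]
  rw [Finset.prod_sum, coeff_sum]
  rw [← Finset.sum_boole]
  refine Finset.sum_congr rfl fun p _ => ?_
  rw [← monomial_sum_one, coeff_monomial]

end Coefficient

end Summit.ValiantsHypothesis.ValiantsHypothesis.Theorems.ValuativeFlip
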